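import Summits.QuantumFields.YangMills.Theorems.UnitScaleTiltProp7SymAvgTwSymBridge
import Summits.QuantumFields.YangMills.Theorems.UnitScaleTiltProp7ChartVelocityDexp
import Summits.QuantumFields.YangMills.Theorems.UnitScaleTiltProp7SymFrameBound
import Summits.QuantumFields.YangMills.Theorems.UnitScaleTiltProp7CmapTwSymInputs
import Summits.QuantumFields.YangMills.Theorems.UnitScaleTiltProp7SymAvgRelDiffT3
import HarnessLib

/-!
# Route `UnitScaleTilt`, crux K1 child «MinimiserStabilityRegPr» (stmt-QuantumFields-19200), skeleton v10, stub `stub_existenceMinimalOrbit` (EX), route (α) — **THE TANGENT SPACE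
# OF THE TWISTED SLICE `{A : U̿^{twS}(A) = V·Ū₀⁻¹}` AT THE CHART POINT `A₁`, IN THE LETTERS OF THE RELATIVE AVERAGE AT `U′ = e^{A₁}U₀`** (brick T2 of the chart-side TRANSPORT of
# `hXtw‴`(iii); ★w2-19200 g4's LOCATE memo v1.2 §7 (LIN); junction ★★`Prop7TangentCriticalSplit.tangentCritical_su2_of_split`, glue ✓`Prop7FibreELOfTangentCriticalSU2`).

Cell `ym3-torus`, width seat `ym-ust-20520-w5` (gen 6; TwS-chart lineage).  THEOREMS ONLY (0 `def`, 0 `sorry`).  `--supports stmt-QuantumFields-19200 --as helper`, count-neutral.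
YM₃ on T³ is a ladder rung (R3), not the Clay problem; nothing here claims the stub, the crux, d = 4 or the mass gap.

THE POINT.  The EX knit parametrises configurations near `U₀` by `A ↦ e^{A}U₀` and cuts the fibre with the RE-BASED TWISTED AVERAGE `U̿^{twS}(A)(c) = w_A(c₋)⁻¹·D̄(e^{A}U₀)(c)·w_A(c₊)·D̄(U₀)(c)⁻¹`
(✓`Prop7SymAvgTwSym.dbarTwS`, symmetric accumulated frames `w_A = frameTwS U₀ A`; (1.37)^cov: ✓`gaugeAct_mem_fibre_iff_dbarTwS_eq`).  The glue at the chart point `U′ = e^{A₁}U₀` needs tangent-criticality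
on the kernel of the STRAIGHT linearised average `G′(U′) = QSym(U′)`; the chart supplies criticality along the TWISTED slice through `A₁`.  This file computes the tangent space of the twisted slice
at `A₁ ≠ 0` in `G′(U′)`-letters: with the velocity map `M` of ✓`Prop7ChartVelocityDexp` (T1) and the right-trivialised FRAME RESPONSE `λ_α(y) := (D w_·(y))(A₁)[α]·w_{A₁}(y)⁻¹`,
**`D(logChartTwS U₀)(A₁) α = 0 ⟺ ∀ c, G′(U′)(Mα)(c)·G₁(c) = λ_α(c₋)·G₁(c) − G₁(c)·Ū₀(c)·λ_α(c₊)·Ū₀(c)⁻¹`**, `G₁ = D̄(U′)D̄(U₀)⁻¹` — i.e. a chart direction is slice-tangent iff the straight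
average of its velocity at `U′` is the coarse infinitesimal gauge motion of `D̄(U′)` generated by the frame response.  This is the exact junction where (LIN-1) of the transport must feed the
«response of the symmetric frame tower to gauge directions» ([Balaban1985Averaging] (87)∕(97), [Balaban1985BackgroundPropagators] (3.115)); nothing of that response is claimed here.

WHAT IS PROVED (sorry-free, no definition).
* §1 (generic normed algebra) ★`hasFDerivAt_inv_mul_mul` (product rule for `w₁⁻¹·G·w₂` at a general point, `w₁, w₂` unit-valued) and ★★`fderiv_inv_mul_mul_eq_zero_iff` (its kernel:
  `g h = (r₁h)·w₁⁻¹·G − G·(r₂h)·w₂⁻¹`).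
* §2 ★`hasFDerivAt_mlog_injective` (`‖Y − 1‖ < 1` ⟹ `D log(Y)` exists and is injective: `Dexp(log Y) ∘ Dlog(Y) = id`).
* §3 (member) ★★`hasFDerivAt_dbarTwS (hL) (hr)` — the derivative of `A ↦ (c ↦ U̿^{twS}(A)(c))` AT `A₁` from the derivative `L` at `A₁` of the `U₀`-based relative average (T1 ✓`hasFDerivAt_rel_rebase`) and the
  frames' derivatives `r y` (✓`analyticAt_frameTwS_of_regPr`), by §1 on ✓`dbarTwS_eq_conj`; ★★★`fderiv_dbarTwS_apply_eq_zero_iff` (its `c`-component vanishes on `α` iff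
  `L α c = λ_α(c₋)·G₁(c) − G₁(c)·Ū₀(c)·λ_α(c₊)·Ū₀(c)⁻¹`).
* §4 ★★`hasFDerivAt_logChartTwS_of_dbarTwS` (the log-chart at `A₁`; kernel = kernel of §3's derivative, by §2) and ★★★`fderiv_logChartTwS_apply_eq_zero_iff` (generic `L`, `r`).
* §5 ★★★`fderiv_logChartTwS_apply_eq_zero_iff_of_regPr` — EVERYTHING DISCHARGED at printed-regular `U₀ ∈ 𝔘_k(ε₀)`, `U′ ∈ 𝔘_k(ε₀′)` (`10¹²L³ε₀ ≤ 1`, `10⁹L²e ≤ 1`, `10⁷L³ε₀′ ≤ 1`, `‖A₁‖ < e·η`,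
  `U′(b) = e^{A₁(b)}U₀(b)`): the displayed equivalence with `G′(U′) := fderiv` of the `U′`-based relative average at `0` and `λ_α` through `fderiv` of the frames (+ `hasFDerivAt_frameTwS_at_of_regPr`,
  `norm_dbarTwS_sub_one_lt_one_of_regPr`).
(The `𝔰𝔲(2)`-preservation of the velocity map `g(ad(−A₁))` is the sibling file `…Prop7ChartVelocitySU2`.)
HONEST SCOPE: calculus and group algebra over landed letters; no estimate; the frame response `λ` is only NAMED (as a derivative), not computed; nothing of print is asserted.

References: T. Bałaban, CMP 98 (1985) 17–51 [Balaban1985Averaging] ((11) p.19, (32)–(34) pp.22–23, (87)–(92) p.31, (97) p.32); CMP 99 (1985) 389–434 [Balaban1985BackgroundPropagators] ((3.13)–(3.14)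
p.393, (3.115) p.418); CMP 102 (1985) 277–309 [Balaban1985Variational] ((44), (47)–(49) p.285, (82)–(83) p.290).
-/

set_option autoImplicit false

noncomputable section

open scoped BigOperators Matrix.Norms.L2Operator Matrix Topology RightActions Nat
open Filter

namespace Summit.QuantumFields.YangMills.Theorems.Prop7TwistedSliceTangent

open NormedSpace
open Literature.MathematicalPhysics.QuantumFieldTheory.Balaban1983to89
open Literature.MathematicalPhysics.QuantumFieldTheory.Balaban1983to89.T3ContinuumYM3Torus
open Literature.MathematicalPhysics.QuantumFieldTheory.Balaban1983to89.T3SectALandauChart (bgUnits eta eta_pos)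
open Literature.MathematicalPhysics.QuantumFieldTheory.Balaban1983to89.T3PrintedRegularMinimiser (RegPr)
open B7Prop1Explicit (expUnit val_expUnit)
open MatrixLog (mlog exp_mlog analyticAt_mlog)
open Summit.QuantumFields.YangMills.Theorems.Prop7SymAvgGL (descendToGL)
open Summit.QuantumFields.YangMills.Theorems.Prop7SymAvgTwSym (frameTwS dbarTwS logChartTwS)
open Summit.QuantumFields.YangMills.Theorems.Prop7SymAvgTwSymBridge (dbarTwS_eq_conj)

/-! ## §1 Generic: the derivative of `A ↦ w₁(A)⁻¹ · G(A) · w₂(A)` at a point and its kernel -/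

section Generic

variable {E : Type*} [NormedAddCommGroup E] [NormedSpace ℂ E] {𝔸 : Type*} [NormedRing 𝔸] [NormedAlgebra ℂ 𝔸] [CompleteSpace 𝔸]

/-- **PRODUCT RULE AT A GENERAL POINT FOR `w₁⁻¹·G·w₂`** (`w₁`, `w₂` unit-valued): the derivative at `x` is
`h ↦ −w₁⁻¹·(r₁h)·w₁⁻¹·G·w₂ + w₁⁻¹·(g h)·w₂ + w₁⁻¹·G·(r₂ h)` (values at `x`). [folklore] -/
theorem hasFDerivAt_inv_mul_mul {w₁ w₂ : E → 𝔸ˣ} {G : E → 𝔸} {r₁ r₂ g : E →L[ℂ] 𝔸} {x : E}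
    (hw₁ : HasFDerivAt (fun y => ((w₁ y : 𝔸ˣ) : 𝔸)) r₁ x) (hG : HasFDerivAt G g x) (hw₂ : HasFDerivAt (fun y => ((w₂ y : 𝔸ˣ) : 𝔸)) r₂ x) :
    HasFDerivAt (fun y => (((w₁ y)⁻¹ : 𝔸ˣ) : 𝔸) * G y * ((w₂ y : 𝔸ˣ) : 𝔸))
      ((((-((ContinuousLinearMap.mulLeftRight ℂ 𝔸 (((w₁ x)⁻¹ : 𝔸ˣ) : 𝔸) (((w₁ x)⁻¹ : 𝔸ˣ) : 𝔸)).comp r₁)) <• (G x)) + (((w₁ x)⁻¹ : 𝔸ˣ) : 𝔸) • g) <• ((w₂ x : 𝔸ˣ) : 𝔸)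
        + ((((w₁ x)⁻¹ : 𝔸ˣ) : 𝔸) * G x) • r₂) x := by
  -- the inverse factor: `Ring.inverse ∘ w₁`
  have hinv_eq : (fun y => (((w₁ y)⁻¹ : 𝔸ˣ) : 𝔸)) = fun y => Ring.inverse ((w₁ y : 𝔸ˣ) : 𝔸) := by
    funext y; exact (Ring.inverse_unit _).symm
  have hinv : HasFDerivAt (fun y => (((w₁ y)⁻¹ : 𝔸ˣ) : 𝔸))
      ((-ContinuousLinearMap.mulLeftRight ℂ 𝔸 (((w₁ x)⁻¹ : 𝔸ˣ) : 𝔸) (((w₁ x)⁻¹ : 𝔸ˣ) : 𝔸)).comp r₁) x := by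
    rw [hinv_eq]
    exact (hasFDerivAt_ringInverse (w₁ x)).comp x hw₁
  have h := (hinv.mul' hG).mul' hw₂
  refine h.congr_fderiv ?_
  ext v
  simp only [add_apply, smul_apply, op_smul_eq_mul, smul_eq_mul, ContinuousLinearMap.coe_comp, Function.comp_apply, neg_apply,
    ContinuousLinearMap.mulLeftRight_apply, Pi.mul_apply]
  noncomm_ring

omit [CompleteSpace 𝔸] in
/-- **KERNEL OF THAT DERIVATIVE**: the derivative vanishes on `h` iff
`g h = (r₁ h)·w₁(x)⁻¹·G(x) − G(x)·(r₂ h)·w₂(x)⁻¹` — «the middle factor moves by the infinitesimal conjugation of the outer frames». [folklore] -/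
theorem fderiv_inv_mul_mul_eq_zero_iff {w₁ w₂ : E → 𝔸ˣ} {G : E → 𝔸} {r₁ r₂ g : E →L[ℂ] 𝔸} {x : E} (v : E) :
    ((((-((ContinuousLinearMap.mulLeftRight ℂ 𝔸 (((w₁ x)⁻¹ : 𝔸ˣ) : 𝔸) (((w₁ x)⁻¹ : 𝔸ˣ) : 𝔸)).comp r₁)) <• (G x)) + (((w₁ x)⁻¹ : 𝔸ˣ) : 𝔸) • g) <• ((w₂ x : 𝔸ˣ) : 𝔸)
        + ((((w₁ x)⁻¹ : 𝔸ˣ) : 𝔸) * G x) • r₂) v = 0 ↔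
      g v = r₁ v * (((w₁ x)⁻¹ : 𝔸ˣ) : 𝔸) * G x - G x * (r₂ v * (((w₂ x)⁻¹ : 𝔸ˣ) : 𝔸)) := by
  simp only [add_apply, smul_apply, op_smul_eq_mul, smul_eq_mul, ContinuousLinearMap.coe_comp, Function.comp_apply, neg_apply,
    ContinuousLinearMap.mulLeftRight_apply]
  set a : 𝔸 := (((w₁ x)⁻¹ : 𝔸ˣ) : 𝔸) with ha
  set b : 𝔸 := ((w₂ x : 𝔸ˣ) : 𝔸) with hb
  set bi : 𝔸 := (((w₂ x)⁻¹ : 𝔸ˣ) : 𝔸) with hbi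
  have hab : ((w₁ x : 𝔸ˣ) : 𝔸) * a = 1 := by rw [ha, ← Units.val_mul, mul_inv_cancel, Units.val_one]
  have hbbi : b * bi = 1 := by rw [hb, hbi, ← Units.val_mul, mul_inv_cancel, Units.val_one]
  have hbib : bi * b = 1 := by rw [hb, hbi, ← Units.val_mul, inv_mul_cancel, Units.val_one]
  constructor
  · intro h0
    -- multiply by `w₁(x)` on the left and by `w₂(x)⁻¹` on the right
    have h1 := congrArg (fun z => ((w₁ x : 𝔸ˣ) : 𝔸) * z * bi) h0
    simp only [mul_zero, zero_mul] at h1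
    have key : ((w₁ x : 𝔸ˣ) : 𝔸) * ((-(a * r₁ v * a) * G x + a * g v) * b + a * G x * r₂ v) * bi
        = -((((w₁ x : 𝔸ˣ) : 𝔸) * a) * r₁ v * a * G x * (b * bi)) + (((w₁ x : 𝔸ˣ) : 𝔸) * a) * g v * (b * bi)
          + (((w₁ x : 𝔸ˣ) : 𝔸) * a) * G x * (r₂ v * bi) := by
      noncomm_ring
    rw [key, hab, hbbi, one_mul, one_mul, one_mul, mul_one, mul_one] at h1
    calc g v = (-(r₁ v * a * G x) + g v + G x * (r₂ v * bi)) + r₁ v * a * G x - G x * (r₂ v * bi) := by abel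
      _ = r₁ v * a * G x - G x * (r₂ v * bi) := by rw [h1, zero_add]
  · intro hg
    rw [hg]
    have key : (-(a * r₁ v * a) * G x + a * (r₁ v * a * G x - G x * (r₂ v * bi))) * b + a * G x * r₂ v
        = -(a * G x * r₂ v * (bi * b)) + a * G x * r₂ v := by
      noncomm_ring
    rw [key, hbib, mul_one, neg_add_cancel]

end Generic

/-! ## §2 A local inverse of `exp` has an injective derivative: `log` near `1` -/

section Log

open Literature.Analysis.Calculus.ExpDifferential (dexp hasFDerivAt_exp_dexp)

variable {𝔸 : Type*} [NormedRing 𝔸] [NormedAlgebra ℂ 𝔸] [CompleteSpace 𝔸]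

/-- **`log` IS DIFFERENTIABLE ON `‖Y − 1‖ < 1` WITH AN INJECTIVE DERIVATIVE** (`Dexp(log Y) ∘ Dlog(Y) = id` from `exp ∘ log = id` near `Y`). [folklore] -/
theorem hasFDerivAt_mlog_injective {Y : 𝔸} (hY : ‖Y - 1‖ < 1) :
    HasFDerivAt (mlog : 𝔸 → 𝔸) (fderiv ℂ (mlog : 𝔸 → 𝔸) Y) Y ∧ Function.Injective (fderiv ℂ (mlog : 𝔸 → 𝔸) Y) := by
  have hd : HasFDerivAt (mlog : 𝔸 → 𝔸) (fderiv ℂ (mlog : 𝔸 → 𝔸) Y) Y := (analyticAt_mlog hY).differentiableAt.hasFDerivAt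
  refine ⟨hd, ?_⟩
  -- `exp ∘ log = id` near `Y`
  have hev : ∀ᶠ Z in 𝓝 Y, exp (mlog Z) = Z := by
    have hopen : IsOpen {Z : 𝔸 | ‖Z - 1‖ < 1} := isOpen_lt (continuous_id.sub continuous_const).norm continuous_const
    filter_upwards [hopen.mem_nhds hY] with Z hZ
    exact exp_mlog hZ
  have hcomp : HasFDerivAt (fun Z : 𝔸 => exp (mlog Z)) ((dexp ℂ (mlog Y)).comp (fderiv ℂ (mlog : 𝔸 → 𝔸) Y)) Y :=
    (hasFDerivAt_exp_dexp (𝕂 := ℂ) (mlog Y)).comp Y hd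
  have hid : HasFDerivAt (fun Z : 𝔸 => exp (mlog Z)) (ContinuousLinearMap.id ℂ 𝔸) Y :=
    (hasFDerivAt_id Y).congr_of_eventuallyEq hev
  have heq : (dexp ℂ (mlog Y)).comp (fderiv ℂ (mlog : 𝔸 → 𝔸) Y) = ContinuousLinearMap.id ℂ 𝔸 := hcomp.unique hid
  intro u v huv
  have := congrArg (dexp ℂ (mlog Y)) huv
  have hu : (dexp ℂ (mlog Y)) (fderiv ℂ (mlog : 𝔸 → 𝔸) Y u) = u := by
    simpa using congrArg (fun T : 𝔸 →L[ℂ] 𝔸 => T u) heq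
  have hv : (dexp ℂ (mlog Y)) (fderiv ℂ (mlog : 𝔸 → 𝔸) Y v) = v := by
    simpa using congrArg (fun T : 𝔸 →L[ℂ] 𝔸 => T v) heq
  rw [hu, hv] at this
  exact this

end Log

/-! ## §3 The member: the derivative of the re-based twisted average `A ↦ U̿^{twS}(A)` AT `A₁` and its kernel -/

section Member


variable (F : T3Family) {n K : ℕ} (h : n ≤ K)

/-- ★★ **THE DERIVATIVE OF THE RE-BASED TWISTED AVERAGE AT A GENERAL CHART POINT `A₁`.**  Given the derivative `L` at `A₁` of the `U₀`-based relative average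
`A ↦ (c ↦ D̄(e^{A}U₀)(c)·D̄(U₀)(c)⁻¹)` (✓`Prop7ChartVelocityDexp.hasFDerivAt_rel_rebase`: `L α c = G′(U′)(Mα)(c)·D̄(U′)(c)D̄(U₀)(c)⁻¹`) and the derivatives `r y` at `A₁` of the symmetric accumulated frames
`A ↦ w_A(y)` (✓`Prop7SymFrameBound.analyticAt_frameTwS_of_regPr`), the double-bar average `A ↦ (c ↦ U̿^{twS}(A)(c)) = (c ↦ w_A(c₋)⁻¹·[D̄(e^{A}U₀)D̄(U₀)⁻¹](c)·[Ū₀(c)w_A(c₊)Ū₀(c)⁻¹])`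
(✓`dbarTwS_eq_conj`) is differentiable at `A₁`, with the product-rule derivative of §1. [cite: Balaban1985Averaging, (89) p.31, (97) p.32; Balaban1985Variational, (44) p.285, (82)-(83) p.290] -/
theorem hasFDerivAt_dbarTwS (U₀ : GaugeField (F.P K) 0 (Matrix.specialUnitaryGroup (Fin 2) ℂ)) (A₁ : PBond (F.P K) 0 → Matrix (Fin 2) (Fin 2) ℂ)
    {L : (PBond (F.P K) 0 → Matrix (Fin 2) (Fin 2) ℂ) →L[ℂ] (PBond (F.P n) 0 → Matrix (Fin 2) (Fin 2) ℂ)}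
    (hL : HasFDerivAt (fun A : PBond (F.P K) 0 → Matrix (Fin 2) (Fin 2) ℂ => fun c : PBond (F.P n) 0 =>
        ((descendToGL F n K h (fun b => expUnit (A b) * bgUnits F K U₀ b) c : (Matrix (Fin 2) (Fin 2) ℂ)ˣ) : Matrix (Fin 2) (Fin 2) ℂ) *
          (((descendToGL F n K h (bgUnits F K U₀) c)⁻¹ : (Matrix (Fin 2) (Fin 2) ℂ)ˣ) : Matrix (Fin 2) (Fin 2) ℂ)) L A₁)
    {r : Site (F.P n) 0 → ((PBond (F.P K) 0 → Matrix (Fin 2) (Fin 2) ℂ) →L[ℂ] Matrix (Fin 2) (Fin 2) ℂ)}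
    (hr : ∀ y, HasFDerivAt (fun A : PBond (F.P K) 0 → Matrix (Fin 2) (Fin 2) ℂ => ((frameTwS F n K h U₀ A y : (Matrix (Fin 2) (Fin 2) ℂ)ˣ) : Matrix (Fin 2) (Fin 2) ℂ)) (r y) A₁) :
    HasFDerivAt (fun A : PBond (F.P K) 0 → Matrix (Fin 2) (Fin 2) ℂ => fun c : PBond (F.P n) 0 => ((dbarTwS F n K h U₀ A c : (Matrix (Fin 2) (Fin 2) ℂ)ˣ) : Matrix (Fin 2) (Fin 2) ℂ))
      (ContinuousLinearMap.pi fun c : PBond (F.P n) 0 =>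
        ((((-((ContinuousLinearMap.mulLeftRight ℂ (Matrix (Fin 2) (Fin 2) ℂ) (((frameTwS F n K h U₀ A₁ c.src)⁻¹ : (Matrix (Fin 2) (Fin 2) ℂ)ˣ) : Matrix (Fin 2) (Fin 2) ℂ) (((frameTwS F n K h U₀ A₁ c.src)⁻¹ : (Matrix (Fin 2) (Fin 2) ℂ)ˣ) : Matrix (Fin 2) (Fin 2) ℂ)).comp (r c.src))) <• (((descendToGL F n K h (fun b => expUnit (A₁ b) * bgUnits F K U₀ b) c : (Matrix (Fin 2) (Fin 2) ℂ)ˣ) : Matrix (Fin 2) (Fin 2) ℂ) * (((descendToGL F n K h (bgUnits F K U₀) c)⁻¹ : (Matrix (Fin 2) (Fin 2) ℂ)ˣ) : Matrix (Fin 2) (Fin 2) ℂ))) + ((((frameTwS F n K h U₀ A₁ c.src)⁻¹ : (Matrix (Fin 2) (Fin 2) ℂ)ˣ) : Matrix (Fin 2) (Fin 2) ℂ) • ((ContinuousLinearMap.proj c).comp L))) <• (((descendToGL F n K h (bgUnits F K U₀) c * frameTwS F n K h U₀ A₁ c.tgt * (descendToGL F n K h (bgUnits F K U₀) c)⁻¹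 : (Matrix (Fin 2) (Fin 2) ℂ)ˣ)) : Matrix (Fin 2) (Fin 2) ℂ)
          + (((((frameTwS F n K h U₀ A₁ c.src)⁻¹ : (Matrix (Fin 2) (Fin 2) ℂ)ˣ) : Matrix (Fin 2) (Fin 2) ℂ) * (((descendToGL F n K h (fun b => expUnit (A₁ b) * bgUnits F K U₀ b) c : (Matrix (Fin 2) (Fin 2) ℂ)ˣ) : Matrix (Fin 2) (Fin 2) ℂ) * (((descendToGL F n K h (bgUnits F K U₀) c)⁻¹ : (Matrix (Fin 2) (Fin 2) ℂ)ˣ) : Matrix (Fin 2) (Fin 2) ℂ))) • ((ContinuousLinearMap.mulLeftRight ℂ (Matrix (Fin 2) (Fin 2) ℂ) ((descendToGL F n K h (bgUnits F K U₀) c : (Matrix (Fin 2) (Fin 2) ℂ)ˣ) : Matrix (Fin 2) (Fin 2) ℂ) (((descendToGL F n K h (bgUnits F K U₀) c)⁻¹ : (Matrix (Fin 2) (Fin 2) ℂ)ˣ) : Matrix (Fin 2) (Fin 2) ℂ)).comp (r c.tgt))))) A₁ := by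
  apply hasFDerivAt_pi''
  intro c
  -- the three factors at the bond `c`
  set P₀ : (Matrix (Fin 2) (Fin 2) ℂ)ˣ := descendToGL F n K h (bgUnits F K U₀) c with hP₀
  have hw₁ := hr c.src
  have hG : HasFDerivAt (fun A : PBond (F.P K) 0 → Matrix (Fin 2) (Fin 2) ℂ =>
      ((descendToGL F n K h (fun b => expUnit (A b) * bgUnits F K U₀ b) c : (Matrix (Fin 2) (Fin 2) ℂ)ˣ) : Matrix (Fin 2) (Fin 2) ℂ) * ((P₀⁻¹ : (Matrix (Fin 2) (Fin 2) ℂ)ˣ) : Matrix (Fin 2) (Fin 2) ℂ))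
      ((ContinuousLinearMap.proj c).comp L) A₁ := (hasFDerivAt_pi'.1 hL) c
  have hw₂ : HasFDerivAt (fun A : PBond (F.P K) 0 → Matrix (Fin 2) (Fin 2) ℂ => ((P₀ * frameTwS F n K h U₀ A c.tgt * P₀⁻¹ : (Matrix (Fin 2) (Fin 2) ℂ)ˣ) : Matrix (Fin 2) (Fin 2) ℂ))
      ((ContinuousLinearMap.mulLeftRight ℂ (Matrix (Fin 2) (Fin 2) ℂ) (P₀ : Matrix (Fin 2) (Fin 2) ℂ) ((P₀⁻¹ : (Matrix (Fin 2) (Fin 2) ℂ)ˣ) : Matrix (Fin 2) (Fin 2) ℂ)).comp (r c.tgt)) A₁ := by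
    have h1 := ((hr c.tgt).const_mul (P₀ : Matrix (Fin 2) (Fin 2) ℂ)).mul_const' ((P₀⁻¹ : (Matrix (Fin 2) (Fin 2) ℂ)ˣ) : Matrix (Fin 2) (Fin 2) ℂ)
    have hfun : (fun A : PBond (F.P K) 0 → Matrix (Fin 2) (Fin 2) ℂ => ((P₀ * frameTwS F n K h U₀ A c.tgt * P₀⁻¹ : (Matrix (Fin 2) (Fin 2) ℂ)ˣ) : Matrix (Fin 2) (Fin 2) ℂ))
        = fun A => (P₀ : Matrix (Fin 2) (Fin 2) ℂ) * ((frameTwS F n K h U₀ A c.tgt : (Matrix (Fin 2) (Fin 2) ℂ)ˣ) : Matrix (Fin 2) (Fin 2) ℂ) * ((P₀⁻¹ : (Matrix (Fin 2) (Fin 2) ℂ)ˣ) : Matrix (Fin 2) (Fin 2) ℂ) := by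
      funext A; simp only [Units.val_mul]
    rw [hfun]
    refine h1.congr_fderiv ?_
    ext v
    simp only [smul_apply, op_smul_eq_mul, smul_eq_mul, ContinuousLinearMap.coe_comp, Function.comp_apply, ContinuousLinearMap.mulLeftRight_apply]
  have key := hasFDerivAt_inv_mul_mul hw₁ hG hw₂
  -- identify the function with `dbarTwS` and the derivative with the stated one
  have hfun : (fun A : PBond (F.P K) 0 → Matrix (Fin 2) (Fin 2) ℂ => ((dbarTwS F n K h U₀ A c : (Matrix (Fin 2) (Fin 2) ℂ)ˣ) : Matrix (Fin 2) (Fin 2) ℂ))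
      = fun A => (((frameTwS F n K h U₀ A c.src)⁻¹ : (Matrix (Fin 2) (Fin 2) ℂ)ˣ) : Matrix (Fin 2) (Fin 2) ℂ) *
          (((descendToGL F n K h (fun b => expUnit (A b) * bgUnits F K U₀ b) c : (Matrix (Fin 2) (Fin 2) ℂ)ˣ) : Matrix (Fin 2) (Fin 2) ℂ) * ((P₀⁻¹ : (Matrix (Fin 2) (Fin 2) ℂ)ˣ) : Matrix (Fin 2) (Fin 2) ℂ)) *
          ((P₀ * frameTwS F n K h U₀ A c.tgt * P₀⁻¹ : (Matrix (Fin 2) (Fin 2) ℂ)ˣ) : Matrix (Fin 2) (Fin 2) ℂ) := by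
    funext A
    rw [dbarTwS_eq_conj]
    simp only [Units.val_mul, hP₀]
  rw [hfun]
  refine key.congr_fderiv ?_
  rw [ContinuousLinearMap.proj_pi]

/-- ★★★ **THE TANGENT SPACE OF THE TWISTED SLICE AT `A₁`, COORDINATEWISE**: with `L`, `r` as in `hasFDerivAt_dbarTwS`, the `c`-component of the derivative vanishes on `α` iff
`L α c = λ_α(c₋)·G₁(c) − G₁(c)·Ū₀(c)·λ_α(c₊)·Ū₀(c)⁻¹`, where `G₁(c) := D̄(e^{A₁}U₀)(c)·D̄(U₀)(c)⁻¹` and `λ_α(y) := (r y α)·w_{A₁}(y)⁻¹` is the RIGHT-TRIVIALISED FRAME RESPONSE (the middle factor moves by the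
infinitesimal conjugation of the outer frames). [cite: Balaban1985Averaging, (89) p.31, (11) p.19; Balaban1985Variational, (44) p.285, (82)-(83) p.290] -/
theorem fderiv_dbarTwS_apply_eq_zero_iff (U₀ : GaugeField (F.P K) 0 (Matrix.specialUnitaryGroup (Fin 2) ℂ)) (A₁ : PBond (F.P K) 0 → Matrix (Fin 2) (Fin 2) ℂ)
    (L : (PBond (F.P K) 0 → Matrix (Fin 2) (Fin 2) ℂ) →L[ℂ] (PBond (F.P n) 0 → Matrix (Fin 2) (Fin 2) ℂ))
    (r : Site (F.P n) 0 → ((PBond (F.P K) 0 → Matrix (Fin 2) (Fin 2) ℂ) →L[ℂ] Matrix (Fin 2) (Fin 2) ℂ)) (α : PBond (F.P K) 0 → Matrix (Fin 2) (Fin 2) ℂ) (c : PBond (F.P n) 0) :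
    ((((-((ContinuousLinearMap.mulLeftRight ℂ (Matrix (Fin 2) (Fin 2) ℂ) (((frameTwS F n K h U₀ A₁ c.src)⁻¹ : (Matrix (Fin 2) (Fin 2) ℂ)ˣ) : Matrix (Fin 2) (Fin 2) ℂ) (((frameTwS F n K h U₀ A₁ c.src)⁻¹ : (Matrix (Fin 2) (Fin 2) ℂ)ˣ) : Matrix (Fin 2) (Fin 2) ℂ)).comp (r c.src))) <• (((descendToGL F n K h (fun b => expUnit (A₁ b) * bgUnits F K U₀ b) c : (Matrix (Fin 2) (Fin 2) ℂ)ˣ) : Matrix (Fin 2) (Fin 2) ℂ) * (((descendToGL F n K h (bgUnits F K U₀) c)⁻¹ : (Matrix (Fin 2) (Fin 2) ℂ)ˣ) : Matrix (Fin 2) (Fin 2) ℂ))) + ((((frameTwS F n K h U₀ A₁ c.src)⁻¹ : (Matrix (Fin 2) (Fin 2) ℂ)ˣ) : Matrix (Fin 2) (Fin 2) ℂ) • ((ContinuousLinearMap.proj c).comp L))) <• (((descendToGL F n K h (bgUnits F K U₀) c * frameTwS F n K h U₀ A₁ c.tgt * (descendToGL F n K h (bgUnits F K U₀) c)⁻¹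 : (Matrix (Fin 2) (Fin 2) ℂ)ˣ)) : Matrix (Fin 2) (Fin 2) ℂ)
          + (((((frameTwS F n K h U₀ A₁ c.src)⁻¹ : (Matrix (Fin 2) (Fin 2) ℂ)ˣ) : Matrix (Fin 2) (Fin 2) ℂ) * (((descendToGL F n K h (fun b => expUnit (A₁ b) * bgUnits F K U₀ b) c : (Matrix (Fin 2) (Fin 2) ℂ)ˣ) : Matrix (Fin 2) (Fin 2) ℂ) * (((descendToGL F n K h (bgUnits F K U₀) c)⁻¹ : (Matrix (Fin 2) (Fin 2) ℂ)ˣ) : Matrix (Fin 2) (Fin 2) ℂ))) • ((ContinuousLinearMap.mulLeftRight ℂ (Matrix (Fin 2) (Fin 2) ℂ) ((descendToGL F n K h (bgUnits F K U₀) c : (Matrix (Fin 2) (Fin 2) ℂ)ˣ) : Matrix (Fin 2) (Fin 2) ℂ) (((descendToGL F n K h (bgUnits F K U₀) c)⁻¹ : (Matrix (Fin 2) (Fin 2) ℂ)ˣ) : Matrix (Fin 2) (Fin 2) ℂ)).comp (r c.tgt)))) α = 0 ↔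
      L α c = r c.src α * (((frameTwS F n K h U₀ A₁ c.src)⁻¹ : (Matrix (Fin 2) (Fin 2) ℂ)ˣ) : Matrix (Fin 2) (Fin 2) ℂ) * (((descendToGL F n K h (fun b => expUnit (A₁ b) * bgUnits F K U₀ b) c : (Matrix (Fin 2) (Fin 2) ℂ)ˣ) : Matrix (Fin 2) (Fin 2) ℂ) * (((descendToGL F n K h (bgUnits F K U₀) c)⁻¹ : (Matrix (Fin 2) (Fin 2) ℂ)ˣ) : Matrix (Fin 2) (Fin 2) ℂ))
        - (((descendToGL F n K h (fun b => expUnit (A₁ b) * bgUnits F K U₀ b) c : (Matrix (Fin 2) (Fin 2) ℂ)ˣ) : Matrix (Fin 2) (Fin 2) ℂ) * (((descendToGL F n K h (bgUnits F K U₀) c)⁻¹ : (Matrix (Fin 2) (Fin 2) ℂ)ˣ) : Matrix (Fin 2) (Fin 2) ℂ)) * (((descendToGL F n K h (bgUnits F K U₀) c : (Matrix (Fin 2) (Fin 2) ℂ)ˣ) : Matrix (Fin 2) (Fin 2) ℂ) * (r c.tgt α * (((frameTwS F n K h U₀ A₁ c.tgt)⁻¹ : (Matrix (Fin 2) (Fin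 2) ℂ)ˣ) : Matrix (Fin 2) (Fin 2) ℂ)) * (((descendToGL F n K h (bgUnits F K U₀) c)⁻¹ : (Matrix (Fin 2) (Fin 2) ℂ)ˣ) : Matrix (Fin 2) (Fin 2) ℂ)) := by
  set P₀ : (Matrix (Fin 2) (Fin 2) ℂ)ˣ := descendToGL F n K h (bgUnits F K U₀) c with hP₀
  have key := fderiv_inv_mul_mul_eq_zero_iff (w₁ := fun A : PBond (F.P K) 0 → Matrix (Fin 2) (Fin 2) ℂ => frameTwS F n K h U₀ A c.src)
    (w₂ := fun A : PBond (F.P K) 0 → Matrix (Fin 2) (Fin 2) ℂ => P₀ * frameTwS F n K h U₀ A c.tgt * P₀⁻¹)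
    (G := fun A : PBond (F.P K) 0 → Matrix (Fin 2) (Fin 2) ℂ =>
      ((descendToGL F n K h (fun b => expUnit (A b) * bgUnits F K U₀ b) c : (Matrix (Fin 2) (Fin 2) ℂ)ˣ) : Matrix (Fin 2) (Fin 2) ℂ) * ((P₀⁻¹ : (Matrix (Fin 2) (Fin 2) ℂ)ˣ) : Matrix (Fin 2) (Fin 2) ℂ))
    (r₁ := r c.src) (r₂ := (ContinuousLinearMap.mulLeftRight ℂ (Matrix (Fin 2) (Fin 2) ℂ) (P₀ : Matrix (Fin 2) (Fin 2) ℂ) ((P₀⁻¹ : (Matrix (Fin 2) (Fin 2) ℂ)ˣ) : Matrix (Fin 2) (Fin 2) ℂ)).comp (r c.tgt))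
    (g := (ContinuousLinearMap.proj c).comp L) (x := A₁) α
  rw [key]
  -- the right-hand sides agree: `(P₀·r·P₀⁻¹)·(P₀·w·P₀⁻¹)⁻¹ = P₀·(r·w⁻¹)·P₀⁻¹`
  have hconj : ((ContinuousLinearMap.mulLeftRight ℂ (Matrix (Fin 2) (Fin 2) ℂ) (P₀ : Matrix (Fin 2) (Fin 2) ℂ) ((P₀⁻¹ : (Matrix (Fin 2) (Fin 2) ℂ)ˣ) : Matrix (Fin 2) (Fin 2) ℂ)).comp (r c.tgt)) α *
        (((P₀ * frameTwS F n K h U₀ A₁ c.tgt * P₀⁻¹)⁻¹ : (Matrix (Fin 2) (Fin 2) ℂ)ˣ) : Matrix (Fin 2) (Fin 2) ℂ)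
      = (P₀ : Matrix (Fin 2) (Fin 2) ℂ) * (r c.tgt α * (((frameTwS F n K h U₀ A₁ c.tgt)⁻¹ : (Matrix (Fin 2) (Fin 2) ℂ)ˣ) : Matrix (Fin 2) (Fin 2) ℂ)) *
          ((P₀⁻¹ : (Matrix (Fin 2) (Fin 2) ℂ)ˣ) : Matrix (Fin 2) (Fin 2) ℂ) := by
    rw [mul_inv_rev, mul_inv_rev, inv_inv, ContinuousLinearMap.coe_comp, Function.comp_apply, ContinuousLinearMap.mulLeftRight_apply, Units.val_mul, Units.val_mul]
    rw [mul_assoc ((P₀ : Matrix (Fin 2) (Fin 2) ℂ) * r c.tgt α), ← mul_assoc ((P₀⁻¹ : (Matrix (Fin 2) (Fin 2) ℂ)ˣ) : Matrix (Fin 2) (Fin 2) ℂ), ← Units.val_mul, inv_mul_cancel, Units.val_one, one_mul]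
    noncomm_ring
  rw [hconj]
  simp only [ContinuousLinearMap.coe_comp, Function.comp_apply, ContinuousLinearMap.proj_apply, hP₀]

/-! ## §4 The log-chart: `ker D(logChartTwS U₀)(A₁) = ker D(U̿^{twS})(A₁)` coordinatewise -/

/-- ★★ **THE TWISTED LOG-CHART AT `A₁`**: with `D` the derivative of `A ↦ (c ↦ U̿^{twS}(A)(c))` at `A₁` (`hasFDerivAt_dbarTwS`) and every `U̿^{twS}(A₁)(c)` inside the `log` window
(`‖· − 1‖ < 1`; at printed-regular backgrounds ✓`Prop7CmapTwSymInputs.norm_dbarTwS_sub_one_le_of_mem_ball`), `logChartTwS U₀ = (c ↦ log U̿^{twS}(·)(c))` is differentiable at `A₁` with derivative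
`c ↦ Dlog(U̿^{twS}(A₁)(c)) ∘ D_c`, and — `Dlog` being injective there (§2) — **its kernel is the kernel of `D`**: `D(logChartTwS U₀)(A₁) α = 0 ↔ D α = 0`.
[cite: Balaban1985Variational, (44) p.285; Balaban1985BackgroundPropagators, (3.13)-(3.14) p.393] -/
theorem hasFDerivAt_logChartTwS_of_dbarTwS (U₀ : GaugeField (F.P K) 0 (Matrix.specialUnitaryGroup (Fin 2) ℂ)) (A₁ : PBond (F.P K) 0 → Matrix (Fin 2) (Fin 2) ℂ)
    {D : (PBond (F.P K) 0 → Matrix (Fin 2) (Fin 2) ℂ) →L[ℂ] (PBond (F.P n) 0 → Matrix (Fin 2) (Fin 2) ℂ)}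
    (hD : HasFDerivAt (fun A : PBond (F.P K) 0 → Matrix (Fin 2) (Fin 2) ℂ => fun c : PBond (F.P n) 0 => ((dbarTwS F n K h U₀ A c : (Matrix (Fin 2) (Fin 2) ℂ)ˣ) : Matrix (Fin 2) (Fin 2) ℂ)) D A₁)
    (hball : ∀ c : PBond (F.P n) 0, ‖((dbarTwS F n K h U₀ A₁ c : (Matrix (Fin 2) (Fin 2) ℂ)ˣ) : Matrix (Fin 2) (Fin 2) ℂ) - 1‖ < 1) :
    HasFDerivAt (logChartTwS F n K h U₀)
      (ContinuousLinearMap.pi fun c : PBond (F.P n) 0 =>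
        (fderiv ℂ (mlog : Matrix (Fin 2) (Fin 2) ℂ → Matrix (Fin 2) (Fin 2) ℂ) ((dbarTwS F n K h U₀ A₁ c : (Matrix (Fin 2) (Fin 2) ℂ)ˣ) : Matrix (Fin 2) (Fin 2) ℂ)).comp ((ContinuousLinearMap.proj c).comp D)) A₁ ∧
    ∀ α : PBond (F.P K) 0 → Matrix (Fin 2) (Fin 2) ℂ,
      (ContinuousLinearMap.pi fun c : PBond (F.P n) 0 =>
        (fderiv ℂ (mlog : Matrix (Fin 2) (Fin 2) ℂ → Matrix (Fin 2) (Fin 2) ℂ) ((dbarTwS F n K h U₀ A₁ c : (Matrix (Fin 2) (Fin 2) ℂ)ˣ) : Matrix (Fin 2) (Fin 2) ℂ)).comp ((ContinuousLinearMap.proj c).comp D)) α = 0 ↔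
      D α = 0 := by
  constructor
  · apply hasFDerivAt_pi''
    intro c
    have hc : HasFDerivAt (fun A : PBond (F.P K) 0 → Matrix (Fin 2) (Fin 2) ℂ => ((dbarTwS F n K h U₀ A c : (Matrix (Fin 2) (Fin 2) ℂ)ˣ) : Matrix (Fin 2) (Fin 2) ℂ))
        ((ContinuousLinearMap.proj c).comp D) A₁ := (hasFDerivAt_pi'.1 hD) c
    have hlog := (hasFDerivAt_mlog_injective (hball c)).1
    have hcomp := hlog.comp A₁ hc
    have hfun : (fun A : PBond (F.P K) 0 → Matrix (Fin 2) (Fin 2) ℂ => logChartTwS F n K h U₀ A c)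
        = (mlog : Matrix (Fin 2) (Fin 2) ℂ → Matrix (Fin 2) (Fin 2) ℂ) ∘ fun A => ((dbarTwS F n K h U₀ A c : (Matrix (Fin 2) (Fin 2) ℂ)ˣ) : Matrix (Fin 2) (Fin 2) ℂ) := by
      funext A; rfl
    rw [hfun]
    refine hcomp.congr_fderiv ?_
    rw [ContinuousLinearMap.proj_pi]
  · intro α
    constructor
    · intro h0
      funext c
      have hc := congr_fun h0 c
      simp only [ContinuousLinearMap.pi_apply, ContinuousLinearMap.coe_comp, Function.comp_apply, ContinuousLinearMap.proj_apply, Pi.zero_apply] at hc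
      have hinj := (hasFDerivAt_mlog_injective (hball c)).2
      have : D α c = 0 := hinj (by rw [hc, map_zero])
      simpa using this
    · intro h0
      funext c
      simp only [ContinuousLinearMap.pi_apply, ContinuousLinearMap.coe_comp, Function.comp_apply, Pi.zero_apply, h0, map_zero]

/-- ★★★ **THE KERNEL OF THE TWISTED LOG-CHART AT `A₁`, IN FRAME-RESPONSE FORM** (generic `L`, `r` as in `hasFDerivAt_dbarTwS`, inside the `log` window):
`D(logChartTwS U₀)(A₁) α = 0 ⟺ ∀ c, L α c = λ_α(c₋)·G₁(c) − G₁(c)·Ū₀(c)·λ_α(c₊)·Ū₀(c)⁻¹`, `λ_α(y) = (r y α)·w_{A₁}(y)⁻¹`, `G₁(c) = D̄(e^{A₁}U₀)(c)·D̄(U₀)(c)⁻¹`.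
[cite: Balaban1985Averaging, (89) p.31, (97) p.32; Balaban1985Variational, (44) p.285, (82)-(83) p.290] -/
theorem fderiv_logChartTwS_apply_eq_zero_iff (U₀ : GaugeField (F.P K) 0 (Matrix.specialUnitaryGroup (Fin 2) ℂ)) (A₁ : PBond (F.P K) 0 → Matrix (Fin 2) (Fin 2) ℂ)
    {L : (PBond (F.P K) 0 → Matrix (Fin 2) (Fin 2) ℂ) →L[ℂ] (PBond (F.P n) 0 → Matrix (Fin 2) (Fin 2) ℂ)}
    (hL : HasFDerivAt (fun A : PBond (F.P K) 0 → Matrix (Fin 2) (Fin 2) ℂ => fun c : PBond (F.P n) 0 =>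
        ((descendToGL F n K h (fun b => expUnit (A b) * bgUnits F K U₀ b) c : (Matrix (Fin 2) (Fin 2) ℂ)ˣ) : Matrix (Fin 2) (Fin 2) ℂ) *
          (((descendToGL F n K h (bgUnits F K U₀) c)⁻¹ : (Matrix (Fin 2) (Fin 2) ℂ)ˣ) : Matrix (Fin 2) (Fin 2) ℂ)) L A₁)
    {r : Site (F.P n) 0 → ((PBond (F.P K) 0 → Matrix (Fin 2) (Fin 2) ℂ) →L[ℂ] Matrix (Fin 2) (Fin 2) ℂ)}
    (hr : ∀ y, HasFDerivAt (fun A : PBond (F.P K) 0 → Matrix (Fin 2) (Fin 2) ℂ => ((frameTwS F n K h U₀ A y : (Matrix (Fin 2) (Fin 2) ℂ)ˣ) : Matrix (Fin 2) (Fin 2) ℂ)) (r y) A₁)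
    (hball : ∀ c : PBond (F.P n) 0, ‖((dbarTwS F n K h U₀ A₁ c : (Matrix (Fin 2) (Fin 2) ℂ)ˣ) : Matrix (Fin 2) (Fin 2) ℂ) - 1‖ < 1)
    (α : PBond (F.P K) 0 → Matrix (Fin 2) (Fin 2) ℂ) :
    fderiv ℂ (logChartTwS F n K h U₀) A₁ α = 0 ↔
      ∀ c : PBond (F.P n) 0, L α c = r c.src α * (((frameTwS F n K h U₀ A₁ c.src)⁻¹ : (Matrix (Fin 2) (Fin 2) ℂ)ˣ) : Matrix (Fin 2) (Fin 2) ℂ) * (((descendToGL F n K h (fun b => expUnit (A₁ b) * bgUnits F K U₀ b) c : (Matrix (Fin 2) (Fin 2) ℂ)ˣ) : Matrix (Fin 2) (Fin 2) ℂ) * (((descendToGL F n K h (bgUnits F K U₀) c)⁻¹ : (Matrix (Fin 2) (Fin 2) ℂ)ˣ) : Matrix (Fin 2) (Fin 2) ℂ))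
        - (((descendToGL F n K h (fun b => expUnit (A₁ b) * bgUnits F K U₀ b) c : (Matrix (Fin 2) (Fin 2) ℂ)ˣ) : Matrix (Fin 2) (Fin 2) ℂ) * (((descendToGL F n K h (bgUnits F K U₀) c)⁻¹ : (Matrix (Fin 2) (Fin 2) ℂ)ˣ) : Matrix (Fin 2) (Fin 2) ℂ)) * (((descendToGL F n K h (bgUnits F K U₀) c : (Matrix (Fin 2) (Fin 2) ℂ)ˣ) : Matrix (Fin 2) (Fin 2) ℂ) * (r c.tgt α * (((frameTwS F n K h U₀ A₁ c.tgt)⁻¹ : (Matrix (Fin 2) (Fin 2) ℂ)ˣ) : Matrix (Fin 2) (Fin 2) ℂ)) * (((descendToGL F n K h (bgUnits F K U₀) c)⁻¹ : (Matrix (Fin 2) (Fin 2) ℂ)ˣ) : Matrix (Fin 2) (Fin 2) ℂ)) := by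
  obtain ⟨hlog, hker⟩ := hasFDerivAt_logChartTwS_of_dbarTwS F h U₀ A₁ (hasFDerivAt_dbarTwS F h U₀ A₁ hL hr) hball
  rw [hlog.fderiv, hker α]
  constructor
  · intro h0 c
    have hc := congr_fun h0 c
    rw [ContinuousLinearMap.pi_apply, Pi.zero_apply] at hc
    exact (fderiv_dbarTwS_apply_eq_zero_iff F h U₀ A₁ L r α c).1 hc
  · intro h1
    funext c
    rw [ContinuousLinearMap.pi_apply, Pi.zero_apply]
    exact (fderiv_dbarTwS_apply_eq_zero_iff F h U₀ A₁ L r α c).2 (h1 c)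

end Member

/-! ## §5 Everything discharged at printed-regular backgrounds: the tangent space of the twisted slice at `A₁` in the letters of `G′(U′)` -/

section RegPr

open Literature.Analysis.Calculus.ExpDifferential (ad gSer)
open Summit.QuantumFields.YangMills.Theorems.Prop7SymFrameBound (analyticAt_frameTwS_of_regPr)
open Summit.QuantumFields.YangMills.Theorems.Prop7CmapTwSymInputs (norm_dbarTwS_sub_one_le_of_mem_ball)
open Summit.QuantumFields.YangMills.Theorems.Prop7SymAvgRelDiffT3 (hasFDerivAt_rel_of_regPr)
open Summit.QuantumFields.YangMills.Theorems.Prop7ChartVelocityDexp (hasFDerivAt_rel_rebase rel_rebase_fderiv_apply)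

variable (F : T3Family) {n K : ℕ} (h : n ≤ K)

/-- **THE FRAMES ARE DIFFERENTIABLE AT `A₁`** (`‖A₁(b)‖ ≤ e·η` bondwise; ✓`analyticAt_frameTwS_of_regPr`). [cite: Balaban1985Averaging, (97) p.32, Prop. 4 p.38] -/
theorem hasFDerivAt_frameTwS_at_of_regPr {ε₀ e : ℝ} (hε₀ : 0 < ε₀) (he : 0 < e) (hWe : 10 ^ 9 * (F.L : ℝ) ^ 2 * e ≤ 1) (hWε : 10 ^ 12 * (F.L : ℝ) ^ 3 * ε₀ ≤ 1)
    (U₀ : GaugeField (F.P K) 0 (Matrix.specialUnitaryGroup (Fin 2) ℂ)) (hreg : RegPr F n K ε₀ U₀) {A₁ : PBond (F.P K) 0 → Matrix (Fin 2) (Fin 2) ℂ}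
    (hA₁ : ∀ b, ‖A₁ b‖ ≤ e * eta F n K) (y : Site (F.P n) 0) :
    HasFDerivAt (fun A : PBond (F.P K) 0 → Matrix (Fin 2) (Fin 2) ℂ => ((frameTwS F n K h U₀ A y : (Matrix (Fin 2) (Fin 2) ℂ)ˣ) : Matrix (Fin 2) (Fin 2) ℂ))
      (fderiv ℂ (fun A : PBond (F.P K) 0 → Matrix (Fin 2) (Fin 2) ℂ => ((frameTwS F n K h U₀ A y : (Matrix (Fin 2) (Fin 2) ℂ)ˣ) : Matrix (Fin 2) (Fin 2) ℂ)) A₁) A₁ :=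
  ((analyticAt_frameTwS_of_regPr F h hε₀ he.le hWε hWe U₀ hreg y hA₁).1).differentiableAt.hasFDerivAt

/-- **THE CHART POINT IS INSIDE THE `log` WINDOW**: `‖U̿^{twS}(A₁)(c) − 1‖ ≤ ½ < 1` for `‖A₁‖ < e·η` (✓`norm_dbarTwS_sub_one_le_of_mem_ball`). [cite: Balaban1985Averaging, (161)-(163) p.42] -/
theorem norm_dbarTwS_sub_one_lt_one_of_regPr {ε₀ e : ℝ} (hε₀ : 0 < ε₀) (he : 0 < e) (hWe : 10 ^ 9 * (F.L : ℝ) ^ 2 * e ≤ 1) (hWε : 10 ^ 12 * (F.L : ℝ) ^ 3 * ε₀ ≤ 1)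
    (U₀ : GaugeField (F.P K) 0 (Matrix.specialUnitaryGroup (Fin 2) ℂ)) (hreg : RegPr F n K ε₀ U₀) {A₁ : PBond (F.P K) 0 → Matrix (Fin 2) (Fin 2) ℂ}
    (hA₁ : ‖A₁‖ < e * eta F n K) (c : PBond (F.P n) 0) :
    ‖((dbarTwS F n K h U₀ A₁ c : (Matrix (Fin 2) (Fin 2) ℂ)ˣ) : Matrix (Fin 2) (Fin 2) ℂ) - 1‖ < 1 :=
  lt_of_le_of_lt (norm_dbarTwS_sub_one_le_of_mem_ball F h hε₀ he hWe hWε U₀ hreg c hA₁).2 (by norm_num)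

/-- ★★★ **THE TANGENT SPACE OF THE TWISTED SLICE `{A : logChartTwS U₀ A = B}` AT THE CHART POINT `A₁`, IN THE LETTERS OF THE RELATIVE AVERAGE AT `U′ = e^{A₁}U₀`** — all inputs discharged at
printed-regular backgrounds (`U₀ ∈ 𝔘_k(ε₀)`, `U′ ∈ 𝔘_k(ε₀′)`, `10¹²L³ε₀ ≤ 1`, `10⁷L³ε₀′ ≤ 1`, `10⁹L²e ≤ 1`, `‖A₁‖ < e·η`): for every direction `α`,
`D(logChartTwS U₀)(A₁) α = 0 ⟺ ∀ c, G′(U′)(Mα)(c)·G₁(c) = λ_α(c₋)·G₁(c) − G₁(c)·Ū₀(c)·λ_α(c₊)·Ū₀(c)⁻¹`, where `G′(U′) := fderiv` of the `U′`-based relative average at `0` (= `QSym(U′)` through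
✓`hasFDerivAt_logChartSym`), `Mα = (g(ad(−A₁ b))(α b))_b` the velocity map, `G₁(c) = D̄(U′)(c)·D̄(U₀)(c)⁻¹`, and `λ_α(y) := (D w_·(y))(A₁)[α]·w_{A₁}(y)⁻¹` the right-trivialised response of the symmetric
accumulated frames.  Reading: a chart direction is tangent to the twisted slice iff the straight linearised average of its velocity AT `U′` is the coarse infinitesimal gauge motion of `D̄(U′)` by the
frame response — the junction where (LIN-1) of the `hXtw‴`(iii) transport must supply «frame response to gauge directions». [cite: Balaban1985Averaging, (11) p.19, (89) p.31, (97) p.32; Balaban1985Variational, (44) p.285, (47)-(49) p.285, (82)-(83) p.290] -/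
theorem fderiv_logChartTwS_apply_eq_zero_iff_of_regPr {ε₀ ε₀' e : ℝ} (hε₀ : 0 < ε₀) (he : 0 < e) (hWe : 10 ^ 9 * (F.L : ℝ) ^ 2 * e ≤ 1) (hWε : 10 ^ 12 * (F.L : ℝ) ^ 3 * ε₀ ≤ 1)
    (hε₀' : 0 < ε₀') (hε' : 10 ^ 7 * (F.L : ℝ) ^ 3 * ε₀' ≤ 1)
    (U₀ U' : GaugeField (F.P K) 0 (Matrix.specialUnitaryGroup (Fin 2) ℂ)) (hreg : RegPr F n K ε₀ U₀) (hreg' : RegPr F n K ε₀' U')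
    (A₁ : PBond (F.P K) 0 → Matrix (Fin 2) (Fin 2) ℂ) (hA₁ : ‖A₁‖ < e * eta F n K)
    (hU' : ∀ b, ((U' b : Matrix.specialUnitaryGroup (Fin 2) ℂ) : Matrix (Fin 2) (Fin 2) ℂ) = exp (A₁ b) * ((U₀ b : Matrix.specialUnitaryGroup (Fin 2) ℂ) : Matrix (Fin 2) (Fin 2) ℂ))
    (α : PBond (F.P K) 0 → Matrix (Fin 2) (Fin 2) ℂ) :
    fderiv ℂ (logChartTwS F n K h U₀) A₁ α = 0 ↔
      ∀ c : PBond (F.P n) 0,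
        (fderiv ℂ (fun A : PBond (F.P K) 0 → Matrix (Fin 2) (Fin 2) ℂ => fun c : PBond (F.P n) 0 =>
            ((descendToGL F n K h (fun b => expUnit (A b) * bgUnits F K U' b) c : (Matrix (Fin 2) (Fin 2) ℂ)ˣ) : Matrix (Fin 2) (Fin 2) ℂ) *
              (((descendToGL F n K h (bgUnits F K U') c)⁻¹ : (Matrix (Fin 2) (Fin 2) ℂ)ˣ) : Matrix (Fin 2) (Fin 2) ℂ)) 0
            (fun b => gSer ℂ (ad ℂ (-A₁ b)) (α b)) c) *
          (((descendToGL F n K h (bgUnits F K U') c : (Matrix (Fin 2) (Fin 2) ℂ)ˣ) : Matrix (Fin 2) (Fin 2) ℂ) *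
            (((descendToGL F n K h (bgUnits F K U₀) c)⁻¹ : (Matrix (Fin 2) (Fin 2) ℂ)ˣ) : Matrix (Fin 2) (Fin 2) ℂ))
        = fderiv ℂ (fun A : PBond (F.P K) 0 → Matrix (Fin 2) (Fin 2) ℂ => ((frameTwS F n K h U₀ A c.src : (Matrix (Fin 2) (Fin 2) ℂ)ˣ) : Matrix (Fin 2) (Fin 2) ℂ)) A₁ α *
            (((frameTwS F n K h U₀ A₁ c.src)⁻¹ : (Matrix (Fin 2) (Fin 2) ℂ)ˣ) : Matrix (Fin 2) (Fin 2) ℂ) *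
            (((descendToGL F n K h (bgUnits F K U') c : (Matrix (Fin 2) (Fin 2) ℂ)ˣ) : Matrix (Fin 2) (Fin 2) ℂ) *
              (((descendToGL F n K h (bgUnits F K U₀) c)⁻¹ : (Matrix (Fin 2) (Fin 2) ℂ)ˣ) : Matrix (Fin 2) (Fin 2) ℂ))
          - (((descendToGL F n K h (bgUnits F K U') c : (Matrix (Fin 2) (Fin 2) ℂ)ˣ) : Matrix (Fin 2) (Fin 2) ℂ) *
              (((descendToGL F n K h (bgUnits F K U₀) c)⁻¹ : (Matrix (Fin 2) (Fin 2) ℂ)ˣ) : Matrix (Fin 2) (Fin 2) ℂ)) *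
            (((descendToGL F n K h (bgUnits F K U₀) c : (Matrix (Fin 2) (Fin 2) ℂ)ˣ) : Matrix (Fin 2) (Fin 2) ℂ) *
              (fderiv ℂ (fun A : PBond (F.P K) 0 → Matrix (Fin 2) (Fin 2) ℂ => ((frameTwS F n K h U₀ A c.tgt : (Matrix (Fin 2) (Fin 2) ℂ)ˣ) : Matrix (Fin 2) (Fin 2) ℂ)) A₁ α *
                (((frameTwS F n K h U₀ A₁ c.tgt)⁻¹ : (Matrix (Fin 2) (Fin 2) ℂ)ˣ) : Matrix (Fin 2) (Fin 2) ℂ)) *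
              (((descendToGL F n K h (bgUnits F K U₀) c)⁻¹ : (Matrix (Fin 2) (Fin 2) ℂ)ˣ) : Matrix (Fin 2) (Fin 2) ℂ)) := by
  -- bondwise size of `A₁`
  have hA₁b : ∀ b, ‖A₁ b‖ ≤ e * eta F n K := fun b => (norm_le_pi_norm A₁ b).trans hA₁.le
  -- the configuration `e^{A₁}U₀♭ = U′♭`
  have hcfg : (fun b => expUnit (A₁ b) * bgUnits F K U₀ b) = bgUnits F K U' := by
    funext b
    apply Units.ext
    rw [Units.val_mul, val_expUnit]
    show exp (A₁ b) * ((U₀ b : Matrix.specialUnitaryGroup (Fin 2) ℂ) : Matrix (Fin 2) (Fin 2) ℂ) = ((U' b : Matrix.specialUnitaryGroup (Fin 2) ℂ) : Matrix (Fin 2) (Fin 2) ℂ)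
    rw [hU' b]
  -- (T1) the `U₀`-based relative average differentiated at `A₁` through `G′(U′)`; the frames at `A₁`; the window
  have hL := hasFDerivAt_rel_rebase F h U₀ U' A₁ hU' (hasFDerivAt_rel_of_regPr F h hε₀' hε' U' hreg')
  have hr := fun y => hasFDerivAt_frameTwS_at_of_regPr F h hε₀ he hWe hWε U₀ hreg hA₁b y
  have hball := norm_dbarTwS_sub_one_lt_one_of_regPr F h hε₀ he hWe hWε U₀ hreg hA₁
  rw [fderiv_logChartTwS_apply_eq_zero_iff F h U₀ A₁ hL hr hball α]
  refine forall_congr' fun c => ?_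
  rw [rel_rebase_fderiv_apply, hcfg]

end RegPr

end Summit.QuantumFields.YangMills.Theorems.Prop7TwistedSliceTangent

end
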